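import Literature.AnabelianGeometry.SemiGraphs.TemperedAnabelianMorphisms
import Literature.AnabelianGeometry.SemiGraphs.TemperedCurveHyperbolicWitness
import HarnessLib

/-!
# [SemiAnbd] Thm 6.4 datum `TemperedCurveHom`: NON-VACUITY of the interface (abc-iut L3 inhabitation
# census v1, row `TemperedCurveHom`: zero producers)

Mochizuki, *Semi-graphs of anabelioids*, Publ. RIMS **42** (2006), §6, Theorem 6.4 (pp. 70–71; PRIMS
pp. 290–291) [cite: MochizukiSemiAnbd2006, Thm 6.4 pp.70-71]: the tempered anabelian theorem is typed
(abc-iut-L3-t4, `TemperedAnabelianMorphisms.lean`) over the INTERFACE record `TemperedCurveHom X Y` = «the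
SET of dominant morphisms `X_K → Y_L`, each with its induced `Π^temp_{X_K} → Π^temp_{Y_L}`»; every named fact of
Thm 6.4 / 6.8 quantifies over it, and the tree had no instance (INHABITATION-CENSUS-L3-v1 §A1).

PROOF-ONLY file (abc-iut cell, wave-4 prover abc-iut-w4-d098; no `def`/`instance`/`structure` declared).
Witnesses, HONESTLY LABELLED:
* `TemperedCurveHom.nonempty_identityModel X` — for EVERY tempered curve `X`, the record whose set of
  dominant morphisms `X_K → X_K` is the singleton `{id}` with `π₁(id) = id`.  This is the identity
  morphism, genuine as far as it goes; it is NOT print's full set of dominant endomorphisms (which may be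
  larger: automorphisms of the curve), so the label is «identity model», not «model».
* `TemperedCurveHom.nonempty_emptyModel X Y` — for every pair, the record with NO dominant morphisms
  (DEGENERATE; e.g. the honest value when `X_K`, `Y_L` admit none).
* `TemperedCurveHom.exists_pair` — a pair of tempered curves with a morphism datum exists outright
  (abc-iut-L3's `TemperedCurve.toyHyperbolic`).
Nothing here asserts Thm 6.4; nothing bears on [IUTchIII] Cor. 3.12.
-/

namespace Literature.AnabelianGeometry.SemiGraphs

universe u

variable {p : ℕ} [Fact p.Prime]

/-- **Identity model** of the Thm 6.4 datum at `(X, X)`: dominant morphisms `:= {id}`, `π₁(id) := id`.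
(Not the full printed set of dominant endomorphisms — see the module docstring.)
[cite: MochizukiSemiAnbd2006, Thm 6.4 pp.70-71] -/
theorem TemperedCurveHom.nonempty_identityModel (X : TemperedCurve p) : Nonempty (TemperedCurveHom p X X) :=
  ⟨{ DomHom := PUnit, pi1 := fun _ => ContinuousMonoidHom.id X.PiTemp }⟩

/-- **Degenerate model** of the Thm 6.4 datum at any pair: NO dominant morphisms (the empty set; honest
e.g. when no dominant `X_K → Y_L` exists). DEGENERATE witness. [cite: MochizukiSemiAnbd2006, Thm 6.4 pp.70-71] -/
theorem TemperedCurveHom.nonempty_emptyModel (X Y : TemperedCurve p) : Nonempty (TemperedCurveHom p X Y) :=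
  ⟨{ DomHom := PEmpty, pi1 := fun e => e.elim }⟩

/-- A pair of tempered curves carrying a (non-empty) morphism datum exists outright: the identity model on
abc-iut-L3's `TemperedCurve.toyHyperbolic`. [cite: MochizukiSemiAnbd2006, Thm 6.4 pp.70-71] -/
theorem TemperedCurveHom.exists_pair :
    ∃ (X Y : TemperedCurve p) (H : TemperedCurveHom p X Y), Nonempty H.DomHom :=
  ⟨TemperedCurve.toyHyperbolic p, TemperedCurve.toyHyperbolic p,
    { DomHom := PUnit, pi1 := fun _ => ContinuousMonoidHom.id _ }, ⟨PUnit.unit⟩⟩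

end Literature.AnabelianGeometry.SemiGraphs
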